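import Summits.ValiantsHypothesis.ValiantsHypothesis.Theorems.SymmetroidDescartesDerivedPencilRolleStairLaw

/-!
# Route SymmetroidDescartes — refutation of `DerivedPencilRolle` (stmt-ValiantsHypothesis-18500):
the staircase family — transfer to finite rows and the stub `stub_stair`

The rows of the canonical walks stay below `2^L n`, so the whole analysis on `ℕ × Bool`
transfers to the finite vertex set `Fin (2^L n) × Bool` (restriction of the layers; costs and signs are
preserved; the canonical walk lifts); this proves the registered stub `stub_stair` of the refutation
skeleton `not_DerivedPencilRolle`.
-/

-- single-conjunct layout: Sub = Summit, duplicated namespace component intended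
set_option linter.dupNamespace false

namespace Summit.ValiantsHypothesis.ValiantsHypothesis.Theorems.SymmetroidDescartes.DPR

open scoped BigOperators

section
variable (n L : ℕ)

/-- Rows along a climb walk. [folklore] -/
theorem rows_climbWalk : ∀ (ρ m r : ℕ), ∀ v ∈ climbWalk ρ m r, v.1 ≤ ρ + r
  | _, 0, _, v, hv => by simp [climbWalk] at hv
  | ρ, m + 1, 0, v, hv => by
      rw [climbWalk, climbWalk_zero, ← List.replicate_succ, List.mem_replicate] at hv
      rw [hv.2]; simp
  | ρ, m + 1, r + 1, v, hv => by
      rw [climbWalk, List.mem_cons] at hv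
      rcases hv with rfl | hv
      · simp
      · have := rows_climbWalk (ρ + 1) m r v hv; omega

/-- Rows along a staircase walk. [folklore] -/
theorem rows_stairWalk (e r : ℕ) : ∀ v ∈ stairWalk n e r, v.1 ≤ e + r := by
  intro v hv
  simp only [stairWalk, List.mem_cons, List.mem_append, List.not_mem_nil, or_false] at hv
  rcases hv with rfl | hv | rfl
  · simp
  · exact rows_climbWalk e (n - 1) r v hv
  · simp

/-- Rows along the canonical walk never exceed the exit row `i + σ_k(j)`. [folklore] -/
theorem rows_canon : ∀ (k : ℕ) (p : ℤ) (i j : ℕ), ∀ v ∈ canon n L k p i j, v.1 ≤ i + sig n k j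
  | 0, _, _, _, v, hv => by simp [canon] at hv
  | k + 1, p, i, j, v, hv => by
      rw [canon, List.mem_append, List.mem_append] at hv
      rw [sig]
      rcases hv with hv | hv | hv
      · have := rows_canon k _ _ _ v hv; omega
      · have := rows_stairWalk n _ _ v hv; omega
      · have := rows_canon k _ _ _ v hv; omega

/-- The sharper exit bound `σ_k(j) ≤ (2^k − 1)(n − 1)` (`n ≥ 1`). [folklore] -/
theorem sig_le' (hn : 1 ≤ n) : ∀ (k j : ℕ), sig n k j ≤ (2 ^ k - 1) * (n - 1)
  | 0, _ => by simp [sig]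
  | k + 1, j => by
      rw [sig, pow_succ]
      have h1 := sig_le' hn k (j / n)
      have h2 : j % n + 1 ≤ n := Nat.mod_lt j hn
      have h3 : 1 ≤ 2 ^ k := Nat.one_le_two_pow
      generalize j % n = r at h2 ⊢
      generalize sig n k (j / n) = σ at h1 ⊢
      generalize 2 ^ k = A at h1 h3 ⊢
      zify [h3, (by omega : 1 ≤ A * 2), hn] at h1 ⊢
      nlinarith

/-- `iota` is injective. [folklore] -/
theorem iota_injective (R : ℕ) : Function.Injective (iota R) := by
  intro v v' h
  simp only [iota, Prod.mk.injEq] at h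
  exact Prod.ext (Fin.ext h.1) h.2

/-- Costs are preserved by the restriction. [folklore] -/
theorem walkCost_finLayer (R : ℕ) {K : ℕ} (d : Fin K → ℕ) (lam : ℤ) :
    ∀ (g : List (WLayer (ℕ × Bool) K)) (v : Fin R × Bool) (w : List (Fin R × Bool)),
      walkCost d lam (g.map (finLayer R)) v w = walkCost d lam g (iota R v) (w.map (iota R))
  | [], _, [] => rfl
  | [], _, _ :: _ => rfl
  | _ :: _, _, [] => rfl
  | l :: g, v, v' :: w => by
      rw [List.map_cons, List.map_cons, walkCost_cons_cons, walkCost_cons_cons, walkCost_finLayer R d lam g]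
      rfl

/-- Signs are preserved by the restriction. [folklore] -/
theorem walkSign_finLayer (R : ℕ) {K : ℕ} :
    ∀ (g : List (WLayer (ℕ × Bool) K)) (v : Fin R × Bool) (w : List (Fin R × Bool)),
      walkSign (g.map (finLayer R)) v w = walkSign g (iota R v) (w.map (iota R))
  | [], v, w => by simp
  | _ :: _, _, [] => rfl
  | l :: g, v, v' :: w => by
      rw [List.map_cons, List.map_cons, walkSign_cons_cons, walkSign_cons_cons, walkSign_finLayer R g]
      rfl

/-- `iota ∘ liftV` is the identity on small rows. [folklore] -/
theorem iota_liftV (R : ℕ) (hR : 0 < R) (v : ℕ × Bool) (hv : v.1 < R) : iota R (liftV R hR v) = v := by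
  simp [iota, liftV, Nat.mod_eq_of_lt hv]

/-- The gap of the finest level is `Q ≥ 1`. [folklore] -/
theorem one_le_gapZ_top : 1 ≤ gapZ n L L := by
  have h1 : slopeP n L L = bigQ n L := by simp [slopeP, show L + 1 - L = 1 by omega]
  have h2 : hw n L (L + 1) = 1 := by simp [hw]
  simp only [gapZ, h1, h2, Nat.cast_one, mul_one]
  have := two_le_bigQ n L
  exact_mod_cast (by omega : 1 ≤ bigQ n L)

end

/-- **STUB `stub_stair` — the staircase family.**  For even `n ≥ 2` and `L ≥ 1` the restriction of the
gadget `𝒢_L(0)` to the rows `< 2^L n` is a layered graph with `(2^L − 1)(n + 1)` layers and `L + 1`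
exponent classes; at the `n^L` strictly increasing integer parameters `λ_j = α_L(j) + 2` the canonical
walk of cell `j` is the unique walk of minimal cost from `(0, base)`, with integer gap `≥ 1`, and
its sign is `(-1)^j`. [folklore] -/
theorem stub_stair : ∀ (n L N : ℕ), 2 ≤ n → Even n → 1 ≤ L → N + 1 = n ^ L → ∃ (g : List (WLayer (Fin (2 ^ L * n) × Bool) (L + 1))) (d : Fin (L + 1) → ℕ) (v₀ : Fin (2 ^ L * n) × Bool) (lam : Fin (N + 1) → ℤ) (wstar : Fin (N + 1) → List (Fin (2 ^ L * n) × Bool)) (c : Fin (N + 1) → ℤ), g.length = (2 ^ L - 1) * (n + 1) ∧ StrictMono lam ∧ (∀ j, walkCost d (lam j) g v₀ (wstar j) = (c j : WithTop ℤ)) ∧ (∀ j (w : List (Fin (2 ^ L * n) × Bool)), w ≠ wstar j → ((c j + 1 : ℤ) : WithTop ℤ) ≤ walkCost d (lam j) g v₀ w) ∧ (∀ j, walkSign g v₀ (wstar j) = (-1) ^ (j : ℕ)) := by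
  intro n L N hn he hL hN
  have hn1 : 1 ≤ n := by omega
  set R : ℕ := 2 ^ L * n with hRdef
  have hR : 0 < R := by positivity
  -- rows of the canonical walks are small
  have hrows : ∀ j, ∀ v ∈ canon n L L 0 0 j, v.1 < R := by
    intro j v hv
    have h1 := rows_canon n L L 0 0 j v hv
    have h2 := sig_le' n hn1 L j
    have h3 : 1 ≤ 2 ^ L := Nat.one_le_two_pow
    have h4 : (2 ^ L - 1) * (n - 1) < 2 ^ L * n := by
      zify [h3, hn1]
      nlinarith
    omega
  have hmap : ∀ j, ((canon n L L 0 0 j).map (liftV R hR)).map (iota R) = canon n L L 0 0 j := by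
    intro j
    rw [List.map_map]
    conv_rhs => rw [← List.map_id (canon n L L 0 0 j)]
    refine List.map_congr_left fun v hv => ?_
    exact iota_liftV R hR v (hrows j v hv)
  refine ⟨(gad n L L 0).map (finLayer R), expo n L, (⟨0, hR⟩, false), fun j => lamOf n L j,
    fun j => (canon n L L 0 0 j).map (liftV R hR), fun j => val n L L 0 0 j (lamOf n L j),
    ?_, ?_, ?_, ?_, ?_⟩
  · rw [List.length_map, length_gad n L hn1]
  · intro a b hab
    exact lamOf_lt n L hn1 a b hab (by rw [← hN]; exact b.isLt)
  · intro j
    rw [walkCost_finLayer, hmap]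
    exact walkCost_canon n L hn1 _ L le_rfl 0 0 j
  · intro j w hw
    rw [walkCost_finLayer]
    have hne : w.map (iota R) ≠ canon n L L 0 0 j := by
      intro h
      apply hw
      rw [← hmap j] at h
      exact (List.map_injective_iff.2 (iota_injective R)) h
    have hlaw := law_all n L hn1 L le_rfl 0 0 j (lamOf n L j) (by simp) (by simpa using layers_le_Rtot n L)
      (inCore_lamOf n L j) _ hne
    have hg := one_le_gapZ_top n L
    refine le_trans ?_ hlaw
    exact_mod_cast (by linarith : val n L L 0 0 j (lamOf n L j) + 1 ≤ val n L L 0 0 j (lamOf n L j) + gapZ n L L)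
  · intro j
    rw [walkSign_finLayer, hmap]
    show walkSign (gad n L L 0) (0, false) (canon n L L 0 0 j) = (-1) ^ (j : ℕ)
    rw [walkSign_canon_top n L hn1 hL]
    conv_rhs => rw [← Nat.div_add_mod (j : ℕ) n, pow_add, pow_mul, Even.neg_one_pow he, one_pow, one_mul]


end Summit.ValiantsHypothesis.ValiantsHypothesis.Theorems.SymmetroidDescartes.DPR
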